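import Mathlib.LinearAlgebra.Matrix.SchurComplement
import Mathlib.LinearAlgebra.Matrix.Block
import Literature.MathematicalPhysics.QuantumLattice.GrassmannIntegral
import HarnessLib

/-!
# Nested-dissection vocabulary for the Wilson–Dirac matrix on the discrete four-torus:
# open boxes, Dirichlet cell matrices, the sixteen children, the Schur separator and its factor

Definition request `defn-WilsonCellSchurFactor` (topic `Literature/MathematicalPhysics/QuantumLattice`,
next to `WilsonFermionBlockAveraging` / `BlockFermionRG`; wanted by route
`Summit.QuantumFields.QCD.Theses.NestedDissectionSea`, items `CoerciveSea`, `NegativeCellsDilute`,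
`SchurCellStep`, `DirichletDetReal` and the informal crux `DefectCharging` (stmt-QuantumFields-11314),
whose statements inline this vocabulary as the `let box / hc / hs / d / neg / negT / inner / sing`
and the block expressions of `SchurCellStep`). This file NAMES that vocabulary, verbatim where the
route has a `let` (so the items restate over the names by unfolding; `box`, `hc`, `hs`, `d`, `inner`,
`sing` are literally the bodies below), over the tree's colour-gauged `r = 1` Wilson–Dirac matrix
`wilsonDirac (fundamentalRep (Fin 3)) U μ 1` on `TorusSite 4 N × Fin 3 × Fin 4`
(`QuantumLattice/GrassmannIntegral`).

## Source and what is being named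

Nested dissection (A. George, SIAM J. Numer. Anal. 10 (1973) 345: eliminate the interiors of the
sub-boxes first, the separators last) applied to the lattice Dirac matrix: for an OPEN box `c` of the
torus (sites strictly inside a corner-and-sides window; its lower faces are one-site Dirichlet
sheets) the **Dirichlet cell matrix** `D_c = D_W|_c` is the principal submatrix on the box; halving
every side by floor/ceil gives `2⁴ = 16` children whose open interiors are pairwise separated by
internal sheets (the **internal separator** `Σ = c ∖ ⋃ children`); since `D_W` couples nearest
neighbours only, `D_c` restricted to `⋃ children` is block diagonal, and the one-level Schur
factorisation `det D_c = det(D_c|_children) · det S_Σ`,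
`S_Σ = D_ΣΣ − D_ΣI (D_II)⁻¹ D_IΣ` (Cè–Giusti–Schaefer, Phys. Rev. D 95 (2017) 034503, §2 and App. A:
factorisation of `det Q` through the Schur complement on the boundary of a domain decomposition;
here `I` = children interiors, `Σ` = separator) makes the **separator factor**
`s(c) = det D_c / ∏_children det D_child = det S_Σ` a function of the links INSIDE `c`; it is real
by `γ₅`-hermiticity (Montvay–Münster 1994, §4.2, restricted to a site set). Iterating down a
hierarchy of boxes telescopes `det D_W` into a product of separator factors and leaf determinants
(route items `SchurCellStep`, `DirichletDetReal`; the telescoping/sign bookkeeping is the route's).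

## Contents (all REAL definitions; `N` the torus side, `U` an `SU(3)` lattice gauge field, `μ` the
bare mass)

* `siteBox x s y` / `wilsonBox x s p` — the open box of corner `x` and sides `s` on sites / on the
  Wilson index (`p ↦ siteBox x s p.1`): `∀ i, 0 < (y i − x i).val ∧ (y i − x i).val < s i` (the
  route's `let box`, verbatim);
* `halfCorner s ε`, `halfSides s ε` (`ε : Fin 4 → Bool` picks lower/upper half per direction;
  corner offset `⌊s_i/2⌋` or `0`, side `s_i − ⌊s_i/2⌋` or `⌊s_i/2⌋`: the route's `let hc`, `let hs`,
  verbatim) and `childCorner x s ε = x + halfCorner s ε`; `halfSides_le`, `halfSides_add`;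
* `wilsonCell U μ x s` — the Dirichlet cell matrix
  `Matrix.toSquareBlockProp (wilsonDirac (fundamentalRep (Fin 3)) U μ 1) (wilsonBox x s)` (as
  requested) and `cellDetRe U μ x s = (det wilsonCell).re` (the route's `let d`, verbatim);
* `IsSignDefect U μ j s` — the route's `let neg` with the flavour stripped
  (`neg U j s ↔ ∃ f, IsSignDefect U (mq f) j s`): at the leaf scale `j = 0` the cell determinant at
  corner `0` is negative, at `j > 0` the parent-times-children sign product is negative;
  `IsTopSignDefect U μ` — the route's `let negT` body (whole-torus determinant against the `16`
  top cells);
* `childrenInterior s` — the route's `let inner` / `let I` (membership of a site of the corner-`0`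
  box in some child box), `HasSingularSeparator U μ s τ` — the route's `let sing`, verbatim (a
  vector harmonic on the children interiors, non-zero on the separator, with separator residual
  `< τ² ×` separator mass), its monotonicity `HasSingularSeparator.mono`, and
  `separatorSigmaMin U μ s = sInf {τ | 0 ≤ τ ∧ HasSingularSeparator U μ s τ}` (the `σ_min` of the
  separator operator in this harmonic-extension form; junk `0` when the separator is empty);
* `childrenBlock`, `schurSeparator` (`D_ΣΣ − D_ΣI (D_II)⁻¹ D_IΣ`, verbatim the right factor of
  `SchurCellStep`) and `sepFactor U μ s = det D_c / ∏_ε det D_{child ε}` (complex division, junk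
  when a child determinant vanishes; `= det schurSeparator` under invertibility is exactly route
  item `SchurCellStep`, via Mathlib `Matrix.det_toBlock` + `Matrix.det_fromBlocks₁₁`);
* `dissectionLevel N b₀ j` — level `j` of the halving hierarchy of the corner-`0` top box of sides
  `N` (a list of `(corner, sides)`; a box is halved while all its sides are `≥ 2 b₀`),
  `IsDissectionLeaf b₀ s`, and the products `levelSepFactorProd`, `levelLeafDetProd` entering the
  telescoping identity (whose statement/proof is the route's business, not vendored here).

## Design notes

* Decidability is constructive (`Fin 4`-bounded quantifiers over `ℕ`-comparisons), so
  `{p // wilsonBox x s p}` is a `Fintype` without `Classical`; route files elaborate the same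
  bodies under `open scoped Classical`, which may pick other (propositionally equal) instances —
  restate with the names rather than by `rfl` if an instance mismatch appears.
* Corners of children are RELATIVE to corner `0` in `halfCorner` (as in the route, which works at
  corner `0` by translation invariance of the measure); `childCorner` is the absolute version.
* Torus side `N` arbitrary (`[NeZero N]` as in the route); boxes with `s i ≥ N` wrap — the route
  only uses `s i ≤ N`.
* NOT here: any identity (`SchurCellStep`, `DirichletDetReal`, block-diagonality of the children
  block, telescoping and the sign corollary are route items), probabilities / the phase-quenched
  measure (`CoerciveSea`'s `P`, `wt` stay in the items), spectral projectors and deflation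
  (`DefectCharging` will be typed over `wilsonCell` and `HasSingularSeparator`).

## References

* A. George, *Nested dissection of a regular finite element mesh*, SIAM J. Numer. Anal. 10 (1973)
  345–363.
* M. Cè, L. Giusti, S. Schaefer, *A local factorization of the fermion determinant in lattice
  QCD*, Phys. Rev. D 95 (2017) 034503, §2 and App. A.
* I. Montvay, G. Münster, *Quantum Fields on a Lattice*, CUP 1994, §4.2 ((4.85)–(4.89);
  `γ₅`-hermiticity).
-/

open Matrix
open Literature.Probability.LatticeModels

noncomputable section

namespace Literature.MathematicalPhysics.QuantumLattice

open QuantumFieldTheory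

/-- Local notation: the colour group `SU(3)`. -/
local notation "𝔾" => Matrix.specialUnitaryGroup (Fin 3) ℂ

variable {N : ℕ} [NeZero N]

/-! ### Open boxes of the discrete four-torus and their sixteen children -/

/-- The **open box** of corner `x` and sides `s` in the torus `(ℤ/N)⁴`, on sites: `y` lies in it iff
every coordinate offset `(y i − x i).val ∈ (0, s i)` (strictly: the faces `{offset = 0}` are the
one-site Dirichlet sheets separating neighbouring boxes). Nested dissection, George 1973, §2.
[cite: George1973, §2] -/
def siteBox (x : TorusSite 4 N) (s : Fin 4 → ℕ) (y : TorusSite 4 N) : Prop :=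
  ∀ i, 0 < (y i - x i).val ∧ (y i - x i).val < s i

/-- Membership in a site box is decidable (finitely many `ℕ`-comparisons). [folklore] -/
instance (x : TorusSite 4 N) (s : Fin 4 → ℕ) : DecidablePred (siteBox x s) :=
  fun _ => inferInstanceAs (Decidable (∀ _, _))

/-- The open box on the index set `TorusSite 4 N × Fin 3 × Fin 4` of the Wilson–Dirac matrix (site,
colour, spin): `p` lies in it iff its site does — VERBATIM the `let box` of route items
`CoerciveSea` / `NegativeCellsDilute` / `SchurCellStep`. [cite: George1973, §2] -/
def wilsonBox (x : TorusSite 4 N) (s : Fin 4 → ℕ) (p : TorusSite 4 N × Fin 3 × Fin 4) : Prop :=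
  ∀ i, 0 < (p.1 i - x i).val ∧ (p.1 i - x i).val < s i

/-- Membership in a Wilson-index box is decidable. [folklore] -/
instance (x : TorusSite 4 N) (s : Fin 4 → ℕ) : DecidablePred (wilsonBox x s) :=
  fun _ => inferInstanceAs (Decidable (∀ _, _))

omit [NeZero N] in
/-- `wilsonBox x s p ↔ siteBox x s p.1` (by definition). [folklore] -/
theorem wilsonBox_iff (x : TorusSite 4 N) (s : Fin 4 → ℕ) (p : TorusSite 4 N × Fin 3 × Fin 4) :
    wilsonBox x s p ↔ siteBox x s p.1 :=
  Iff.rfl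

/-- The RELATIVE corner of the child `ε` of a box of sides `s` (floor/ceil halving): offset
`⌊s i / 2⌋` in the directions with `ε i = true`, `0` otherwise — VERBATIM the `let hc` of the route
items (children of the corner-`0` box). [cite: George1973, §2] -/
def halfCorner (s : Fin 4 → ℕ) (ε : Fin 4 → Bool) : TorusSite 4 N :=
  fun i => if ε i then ((s i / 2 : ℕ) : ZMod N) else 0

/-- The sides of the child `ε`: `s i − ⌊s i / 2⌋` (upper half) or `⌊s i / 2⌋` (lower half) —
VERBATIM the `let hs` of the route items. [cite: George1973, §2] -/
def halfSides (s : Fin 4 → ℕ) (ε : Fin 4 → Bool) : Fin 4 → ℕ :=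
  fun i => if ε i then s i - s i / 2 else s i / 2

/-- The absolute corner `x + halfCorner s ε` of the child `ε` of the box `(x, s)`.
[cite: George1973, §2] -/
def childCorner (x : TorusSite 4 N) (s : Fin 4 → ℕ) (ε : Fin 4 → Bool) : TorusSite 4 N :=
  x + halfCorner s ε

omit [NeZero N] in
/-- The children of the corner-`0` box have corner `halfCorner`. [folklore] -/
@[simp] theorem childCorner_zero (s : Fin 4 → ℕ) (ε : Fin 4 → Bool) :
    childCorner (0 : TorusSite 4 N) s ε = halfCorner s ε :=
  zero_add _

/-- Each child side is at most the parent side. [folklore] -/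
theorem halfSides_le (s : Fin 4 → ℕ) (ε : Fin 4 → Bool) (i : Fin 4) : halfSides s ε i ≤ s i := by
  unfold halfSides
  split_ifs
  · exact Nat.sub_le _ _
  · exact Nat.div_le_self _ _

/-- The two halves of a side add up: `⌊s/2⌋ + (s − ⌊s/2⌋) = s`. [folklore] -/
theorem halfSides_add (s : Fin 4 → ℕ) (ε : Fin 4 → Bool) (i : Fin 4) :
    halfSides s ε i + halfSides s (fun j => !ε j) i = s i := by
  unfold halfSides
  cases h : ε i <;> simp [h] <;> omega

/-! ### Dirichlet cell matrices and their determinants -/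

/-- The **Dirichlet cell matrix** of the box `(x, s)`: the principal submatrix of the colour-gauged
`r = 1` Wilson–Dirac matrix `D_W(U, μ, 1)` (`wilsonDirac (fundamentalRep (Fin 3)) U μ 1`) on the open
box, `Matrix.toSquareBlockProp … (wilsonBox x s)` — Dirichlet conditions on the bounding sheets.
Cè–Giusti–Schaefer 2017, §2 (block decomposition of the Dirac operator by domains).
[cite: CeGiustiSchaefer2017, §2] -/
def wilsonCell (U : GaugeConfig 4 N 𝔾) (μ : ℝ) (x : TorusSite 4 N) (s : Fin 4 → ℕ) :
    Matrix {p // wilsonBox x s p} {p // wilsonBox x s p} ℂ :=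
  Matrix.toSquareBlockProp (wilsonDirac (fundamentalRep (Fin 3)) U μ 1) (wilsonBox x s)

/-- The real part of the Dirichlet cell determinant, `d(U, μ, x, s) = Re det D_c` — VERBATIM the
`let d` of route items `CoerciveSea` / `NegativeCellsDilute` (the determinant is real, route item
`DirichletDetReal`, by `γ₅`-hermiticity; Montvay–Münster §4.2). [cite: MontvayMunster1994, §4.2] -/
def cellDetRe (U : GaugeConfig 4 N 𝔾) (μ : ℝ) (x : TorusSite 4 N) (s : Fin 4 → ℕ) : ℝ :=
  (Matrix.toSquareBlockProp (wilsonDirac (fundamentalRep (Fin 3)) U μ 1) (wilsonBox x s)).det.re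

/-- `cellDetRe` is the real part of `det wilsonCell` (by definition). [folklore] -/
theorem cellDetRe_eq (U : GaugeConfig 4 N 𝔾) (μ : ℝ) (x : TorusSite 4 N) (s : Fin 4 → ℕ) :
    cellDetRe U μ x s = (wilsonCell U μ x s).det.re :=
  rfl

/-- **Sign defect of a cell at scale `j`** (the route's `let neg` with the flavour quantifier
stripped: `neg U j s ↔ ∃ f, IsSignDefect U (m_f) j s`): at the leaf scale `j = 0` the corner-`0`
cell of sides `s` has negative determinant; at `j > 0` the product of the parent sign and its
sixteen children signs is negative (a sign change of the separator factor). [cite: George1973, §2] -/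
def IsSignDefect (U : GaugeConfig 4 N 𝔾) (μ : ℝ) (j : ℕ) (s : Fin 4 → ℕ) : Prop :=
  (j = 0 ∧ cellDetRe U μ 0 s < 0) ∨
    (0 < j ∧
      cellDetRe U μ 0 s * ∏ ε : Fin 4 → Bool, cellDetRe U μ (halfCorner s ε) (halfSides s ε) < 0)

/-- **Top-level sign defect** (the route's `let negT` body for one mass): the whole-torus
determinant `Re det D_W(U, μ, 1)` times the signs of the sixteen top cells (children of the
corner-`0` box of sides `N`) is negative. [cite: George1973, §2] -/
def IsTopSignDefect (U : GaugeConfig 4 N 𝔾) (μ : ℝ) : Prop :=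
  (fermionDet (wilsonDirac (fundamentalRep (Fin 3)) U μ 1)).re *
      ∏ ε : Fin 4 → Bool, cellDetRe U μ (halfCorner (fun _ => N) ε) (halfSides (fun _ => N) ε) < 0

/-! ### Children interiors, the internal separator, near-singular separators -/

/-- The **children interior** of the corner-`0` box of sides `s`: a point of the box lies in the
open interior of some child `ε` (the complement inside the box is the internal separator `Σ`) —
VERBATIM the `let inner` of `SchurCellStep` / the `let I` of `CoerciveSea`. [cite: George1973, §2] -/
def childrenInterior (s : Fin 4 → ℕ) (p : {p // wilsonBox (0 : TorusSite 4 N) s p}) : Prop :=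
  ∃ ε : Fin 4 → Bool, wilsonBox (halfCorner s ε) (halfSides s ε) p.1

/-- Membership in the children interior is decidable (sixteen boxes). [folklore] -/
instance (s : Fin 4 → ℕ) : DecidablePred (childrenInterior (N := N) s) :=
  fun _ => inferInstanceAs (Decidable (∃ _, _))

/-- **Near-singular separator** at level `τ` — VERBATIM the `let sing` of route item `CoerciveSea`:
there is a vector `w` on the corner-`0` box of sides `s`, not identically zero on the separator,
harmonic on the children interiors (`(D_c w)(p) = 0` for interior `p`), whose separator residual is
small: `Σ_{p ∈ Σ} ‖(D_c w)(p)‖² < τ² Σ_{p ∈ Σ} ‖w(p)‖²` (the separator operator in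
harmonic-extension form has a singular value below `τ` on the range of the harmonic extension).
[cite: CeGiustiSchaefer2017, §2 and App. A] -/
def HasSingularSeparator (U : GaugeConfig 4 N 𝔾) (μ : ℝ) (s : Fin 4 → ℕ) (τ : ℝ) : Prop :=
  ∃ w : {p // wilsonBox (0 : TorusSite 4 N) s p} → ℂ,
    (∃ p, ¬ childrenInterior s p ∧ w p ≠ 0) ∧
    (∀ p, childrenInterior s p → (wilsonCell U μ 0 s).mulVec w p = 0) ∧
    ∑ p, (if childrenInterior s p then 0 else ‖(wilsonCell U μ 0 s).mulVec w p‖ ^ 2) <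
      τ ^ 2 * ∑ p, (if childrenInterior s p then 0 else ‖w p‖ ^ 2)

/-- Near-singularity is monotone in the level: `0 ≤ τ ≤ τ'` and a `τ`-singular separator give a
`τ'`-singular separator. [folklore] -/
theorem HasSingularSeparator.mono {U : GaugeConfig 4 N 𝔾} {μ : ℝ} {s : Fin 4 → ℕ} {τ τ' : ℝ}
    (h : HasSingularSeparator U μ s τ) (hτ : 0 ≤ τ) (hττ' : τ ≤ τ') :
    HasSingularSeparator U μ s τ' := by
  obtain ⟨w, hw, hharm, hres⟩ := h
  refine ⟨w, hw, hharm, hres.trans_le ?_⟩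
  have hS : 0 ≤ ∑ p, (if childrenInterior s p then 0 else ‖w p‖ ^ 2) :=
    Finset.sum_nonneg fun p _ => by split_ifs <;> positivity
  exact mul_le_mul_of_nonneg_right (pow_le_pow_left₀ hτ hττ' 2) hS

/-- **`σ_min` of the separator operator** (harmonic-extension form): the infimum of the levels
`τ ≥ 0` at which the separator of the corner-`0` box of sides `s` is near-singular. An `sInf` in
`ℝ` over an up-set of `[0, ∞)`; junk value `0` if the set is empty (no non-zero separator vector,
e.g. an empty separator). [cite: CeGiustiSchaefer2017, App. A] -/
def separatorSigmaMin (U : GaugeConfig 4 N 𝔾) (μ : ℝ) (s : Fin 4 → ℕ) : ℝ :=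
  sInf {τ : ℝ | 0 ≤ τ ∧ HasSingularSeparator U μ s τ}

/-- `σ_min ≥ 0`. [folklore] -/
theorem separatorSigmaMin_nonneg (U : GaugeConfig 4 N 𝔾) (μ : ℝ) (s : Fin 4 → ℕ) :
    0 ≤ separatorSigmaMin U μ s :=
  Real.sInf_nonneg fun _ h => h.1

/-- A near-singular level bounds `σ_min` from above. [folklore] -/
theorem separatorSigmaMin_le {U : GaugeConfig 4 N 𝔾} {μ : ℝ} {s : Fin 4 → ℕ} {τ : ℝ} (hτ : 0 ≤ τ)
    (h : HasSingularSeparator U μ s τ) : separatorSigmaMin U μ s ≤ τ :=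
  csInf_le ⟨0, fun _ h' => h'.1⟩ ⟨hτ, h⟩

/-! ### The Schur separator and the separator factor -/

/-- The **children block** `D_II` of the Dirichlet cell matrix of the corner-`0` box of sides `s`
(rows and columns in the children interiors; block diagonal over the sixteen children since `D_W`
couples nearest neighbours only — route item `SchurCellStep`, first clause).
[cite: CeGiustiSchaefer2017, §2] -/
def childrenBlock (U : GaugeConfig 4 N 𝔾) (μ : ℝ) (s : Fin 4 → ℕ) :
    Matrix {p // childrenInterior (N := N) s p} {p // childrenInterior (N := N) s p} ℂ :=
  (wilsonCell U μ 0 s).toBlock (childrenInterior s) (childrenInterior s)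

/-- The **Schur separator matrix** `S_Σ = D_ΣΣ − D_ΣI (D_II)⁻¹ D_IΣ` of the corner-`0` box of sides
`s`: the Schur complement of the Dirichlet cell matrix onto its internal separator
`Σ = box ∖ children interiors` — VERBATIM the right factor of route item `SchurCellStep`
(`Matrix.toBlock` with the predicates `¬ childrenInterior`, `childrenInterior`; Mathlib's
nonsingular inverse, junk when `D_II` is singular). Cè–Giusti–Schaefer 2017, App. A (Schur
complement of the Dirac operator on a domain boundary). [cite: CeGiustiSchaefer2017, App. A] -/
def schurSeparator (U : GaugeConfig 4 N 𝔾) (μ : ℝ) (s : Fin 4 → ℕ) :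
    Matrix {p // ¬ childrenInterior (N := N) s p} {p // ¬ childrenInterior (N := N) s p} ℂ :=
  (wilsonCell U μ 0 s).toBlock (fun p => ¬ childrenInterior s p) (fun p => ¬ childrenInterior s p) -
    (wilsonCell U μ 0 s).toBlock (fun p => ¬ childrenInterior s p) (childrenInterior s) *
        ((wilsonCell U μ 0 s).toBlock (childrenInterior s) (childrenInterior s))⁻¹ *
      (wilsonCell U μ 0 s).toBlock (childrenInterior s) (fun p => ¬ childrenInterior s p)

/-- The **separator factor** `s(c) = det D_c / ∏_ε det D_{child ε}` of the corner-`0` box of sides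
`s` (complex division: junk `det D_c · 0⁻¹ = 0` when a child determinant vanishes). Under
invertibility of the children block it equals `det schurSeparator` (route item `SchurCellStep`:
`det D_II = ∏_ε det D_{child ε}` and `det D_c = det D_II · det S_Σ`, Mathlib `Matrix.det_toBlock`,
`Matrix.det_fromBlocks₁₁`). [cite: CeGiustiSchaefer2017, §2 and App. A] -/
def sepFactor (U : GaugeConfig 4 N 𝔾) (μ : ℝ) (s : Fin 4 → ℕ) : ℂ :=
  (wilsonCell U μ 0 s).det /
    ∏ ε : Fin 4 → Bool, (wilsonCell U μ (halfCorner s ε) (halfSides s ε)).det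

/-- The generic Schur step behind `sepFactor`: for any square matrix and any predicate, if the
`p`-block is invertible then `det M = det M_pp · det (M_qq − M_qp M_pp⁻¹ M_pq)`, `q = ¬p`
(Mathlib's `det_toBlock` and `det_fromBlocks₁₁`). With `M = wilsonCell U μ 0 s` and
`p = childrenInterior s` this is the second clause of route item `SchurCellStep`. [folklore] -/
theorem det_eq_det_toBlock_mul_det_schur {m : Type*} [Fintype m] [DecidableEq m]
    (M : Matrix m m ℂ) (p : m → Prop) [DecidablePred p]
    (hM : IsUnit (M.toBlock p p).det) :
    M.det = (M.toBlock p p).det *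
      (M.toBlock (fun j => ¬ p j) (fun j => ¬ p j) -
        M.toBlock (fun j => ¬ p j) p * (M.toBlock p p)⁻¹ * M.toBlock p (fun j => ¬ p j)).det := by
  letI : Invertible (M.toBlock p p) := Matrix.invertibleOfIsUnitDet _ hM
  rw [Matrix.det_toBlock M p, Matrix.det_fromBlocks₁₁, Matrix.invOf_eq_nonsing_inv]

/-! ### The halving hierarchy of the corner-`0` top box -/

/-- A box of sides `s` is a **leaf** of the dissection at base scale `b₀` iff some side is `< 2 b₀`
(it is not halved any further). [cite: George1973, §2] -/
def IsDissectionLeaf (b₀ : ℕ) (s : Fin 4 → ℕ) : Prop :=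
  ∃ i, s i < 2 * b₀

/-- Being a leaf is decidable. [folklore] -/
instance (b₀ : ℕ) (s : Fin 4 → ℕ) : Decidable (IsDissectionLeaf b₀ s) :=
  inferInstanceAs (Decidable (∃ _, _))

/-- **Level `j` of the halving hierarchy** of the torus of side `N` at base scale `b₀`: the list of
boxes `(corner, sides)` obtained from the top box `(0, (N, N, N, N))` by `j` rounds of floor/ceil
halving, a box being halved iff it is not a leaf (all sides `≥ 2 b₀`); leaves do not propagate to
the next level. Nested dissection ordering, George 1973, §2–§3. [cite: George1973, §2–§3] -/
def dissectionLevel (N b₀ : ℕ) : ℕ → List (TorusSite 4 N × (Fin 4 → ℕ))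
  | 0 => [((0 : TorusSite 4 N), fun _ => N)]
  | j + 1 => (dissectionLevel N b₀ j).flatMap fun c =>
      if IsDissectionLeaf b₀ c.2 then []
      else (Finset.univ : Finset (Fin 4 → Bool)).toList.map fun ε =>
        (childCorner c.1 c.2 ε, halfSides c.2 ε)

/-- Level `0` is the top box. [folklore] -/
@[simp] theorem dissectionLevel_zero (N b₀ : ℕ) :
    dissectionLevel N b₀ 0 = [((0 : TorusSite 4 N), fun _ => N)] :=
  rfl

/-- The **product of the separator factors at level `j`** (over the non-leaf boxes of the level,
translated to corner `0` through the gauge field: the factor of the box `(x, s)` is that of the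
corner-`0` box of sides `s` for the translated field `U(· + x)`), entering the telescoping
`det D_W = (top factor) · ∏_levels ∏_boxes s(c) · ∏_leaves det D_leaf` of the route.
[cite: George1973, §3] -/
def levelSepFactorProd (U : GaugeConfig 4 N 𝔾) (μ : ℝ) (b₀ j : ℕ) : ℂ :=
  ((dissectionLevel N b₀ j).map fun c =>
      if IsDissectionLeaf b₀ c.2 then 1
      else sepFactor (fun e => U (e.1 + c.1, e.2)) μ c.2).prod

/-- The **product of the leaf determinants at level `j`**. [cite: George1973, §3] -/
def levelLeafDetProd (U : GaugeConfig 4 N 𝔾) (μ : ℝ) (b₀ j : ℕ) : ℂ :=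
  ((dissectionLevel N b₀ j).map fun c =>
      if IsDissectionLeaf b₀ c.2 then (wilsonCell U μ c.1 c.2).det else 1).prod

end Literature.MathematicalPhysics.QuantumLattice

end
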